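import Summits.KontsevichZagierPeriods.KontsevichZagierPeriods.Theorems.RootDecompZetaThreeFrontierWordRungTwoP8

/-! # `RootDecompZetaThreeFrontierWordRungTwoP9` — part 9/12 of the mechanical ≤270-line split of `RungTwo.stripped.lean`
(split by the decomp-kz census seat for landing; mathematics unchanged; part 9 continues part 8). -/

/-! # `RootDecompZetaThreeFrontierWordRungTwoP9a` — part 1/2 of the mechanical ≤200-line split of `P9src.lean`
(split by the decomp-kz census seat for landing; mathematics unchanged). -/

noncomputable section

namespace Summit.KontsevichZagierPeriods.RootDecompZetaThreeFrontier.WordLayer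
open Set MeasureTheory MvPolynomial
open Literature.NumberTheory.Transcendental
open Summit.KontsevichZagierPeriods.KontsevichZagierPeriods.Theses.RootDecompZetaThreeFrontier
  (HigherWeightDescent)
open Summit.KontsevichZagierPeriods.KontsevichZagierPeriods.Theses.LinRedNormalForm
  (DihedralNormalForm MzvKernelInKZ HoffmanSpanInKZ HoffmanIndependence)

section Necessity

/-! ### 21a  Polynomial bookkeeping -/

/-- Auxiliary step `continuous_aeval_fin`. [bookkeeping] -/
private theorem continuous_aeval_fin {n : ℕ} (p : MvPolynomial (Fin n) ℚ) :
    Continuous fun x : Fin n → ℝ => MvPolynomial.aeval x p := by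
  have : (fun x : Fin n → ℝ => MvPolynomial.aeval x p) =
      fun x => MvPolynomial.eval x (MvPolynomial.map (algebraMap ℚ ℝ) p) := by
    funext x; rw [MvPolynomial.eval_map, MvPolynomial.aeval_def]
  rw [this]
  exact MvPolynomial.continuous_eval _

/-- the row `t₁ = 0` of `P ∈ ℚ[t₀,t₁]`: the univariate polynomial `P(X, 0)` -/
noncomputable def rowZero (P : MvPolynomial (Fin 2) ℚ) : Polynomial ℚ :=
  ∑ e ∈ P.support with e 1 = 0, Polynomial.monomial (e 0) (MvPolynomial.coeff e P)

/-- Auxiliary step `aeval_rowZero`. [bookkeeping] -/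
theorem aeval_rowZero (P : MvPolynomial (Fin 2) ℚ) {y : Fin 2 → ℝ} (hy : y 1 = 0) :
    MvPolynomial.aeval y P = Polynomial.aeval (y 0) (rowZero P) := by
  rw [aeval_eq_sum_std, rowZero, map_sum, Finset.sum_filter]
  refine Finset.sum_congr rfl fun e _ => ?_
  split_ifs with h
  · rw [Polynomial.aeval_monomial, h, pow_zero, mul_one, eq_ratCast]
  · rw [hy, zero_pow h, mul_zero, mul_zero]

/-- Auxiliary step `coeff_rowZero`. [bookkeeping] -/
theorem coeff_rowZero (P : MvPolynomial (Fin 2) ℚ) (n : ℕ) :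
    (rowZero P).coeff n = MvPolynomial.coeff (Finsupp.single 0 n) P := by
  classical
  rw [rowZero, Polynomial.finsetSum_coeff]
  have key : ∀ e ∈ P.support.filter (fun e : Fin 2 →₀ ℕ => e 1 = 0),
      ((Polynomial.monomial (e 0)) (MvPolynomial.coeff e P)).coeff n =
        if e = Finsupp.single 0 n then MvPolynomial.coeff e P else 0 := by
    intro e he
    have he1 : e 1 = 0 := (Finset.mem_filter.1 he).2
    rw [Polynomial.coeff_monomial]
    have : (e 0 = n) ↔ e = Finsupp.single 0 n := by
      constructor
      · intro h; ext j; fin_cases j <;> simp [h, he1]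
      · intro h; rw [h]; simp
    simp only [this]
  rw [Finset.sum_congr rfl key, Finset.sum_ite_eq']
  split_ifs with h
  · rfl
  · by_cases hs : Finsupp.single (0 : Fin 2) n ∈ P.support
    · exact absurd (Finset.mem_filter.2 ⟨hs, by simp⟩) h
    · exact (MvPolynomial.notMem_support_iff.1 hs).symm

/-- a polynomial all of whose monomials contain `Xᵢ^b` is `Xᵢ^b` times a polynomial -/
theorem exists_X_pow_mul (i : Fin 2) (b : ℕ) (P : MvPolynomial (Fin 2) ℚ) (h : ∀ e ∈ P.support, b ≤ e i) :
    ∃ P' : MvPolynomial (Fin 2) ℚ, P = MvPolynomial.X i ^ b * P' := by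
  refine ⟨∑ e ∈ P.support, MvPolynomial.monomial (e - Finsupp.single i b) (MvPolynomial.coeff e P), ?_⟩
  rw [Finset.mul_sum]
  conv_lhs => rw [P.as_sum]
  refine Finset.sum_congr rfl fun e he => ?_
  rw [MvPolynomial.X_pow_eq_monomial, MvPolynomial.monomial_mul, one_mul, add_tsub_cancel_of_le]
  exact Finsupp.single_le_iff.2 (h e he)

/-- the support of `Xᵢ^b · P'` -/
theorem le_of_mem_support_X_pow_mul (i : Fin 2) (b : ℕ) (P' : MvPolynomial (Fin 2) ℚ) :
    ∀ e ∈ (MvPolynomial.X i ^ b * P').support, b ≤ e i ∧ e - Finsupp.single i b ∈ P'.support := by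
  classical
  intro e he
  rw [MvPolynomial.X_pow_eq_monomial, MvPolynomial.mem_support_iff, MvPolynomial.coeff_monomial_mul'] at he
  split_ifs at he with hle
  · rw [one_mul] at he
    exact ⟨by simpa using (hle i), MvPolynomial.mem_support_iff.2 he⟩
  · exact absurd rfl he

/-! ### 21b  THE FACE LEMMA -/

end Necessity
end Summit.KontsevichZagierPeriods.RootDecompZetaThreeFrontier.WordLayer
end
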